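import Mathlib.LinearAlgebra.UnitaryGroup
import Mathlib.Analysis.Matrix.Normed
import Mathlib.Logic.Equiv.Fin.Rotate
import Literature.Probability.RandomMatrix.SphereCoordinateDensity
import HarnessLib

/-!
# The column fibration `U(N+1) → S^{2N+1}`: an explicit section and block coordinates

Algebraic infrastructure for the computation of the Haar small-ball constant of `U(N)`
(S. Chatterjee, *The leading term of the Yang–Mills free energy*, J. Funct. Anal. 271 (2016),
arXiv:1602.01222, Thm. 6.1: `lim_{δ→0} σ{‖I-U‖ ≤ δ}/δ^{N²} = ∏_{j<N} j!/((2π)^{N/2} 2^{N²/2} Γ(N²/2+1))`),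
which we prove WITHOUT Weyl's integration formula, by induction on `N` along the fibration of
`U(N+1)` over the unit sphere of `ℂ^{N+1}` with fibre `U(N)` (files `UnitaryColumnLaw`,
`UnitaryHaarVolume`). Everything here is elementary matrix algebra over `ℂ`, proved; no definition
of `Prop` type (named fact) is introduced.

We index `ℂ^{N+1} = ℂ^N ⊕ ℂ` by `Idx N = Fin N ⊕ Fin 1` (block matrices), the distinguished basis
vector `e` being the `Fin 1` summand, and transport to `Fin (N+1)` by the reindexing `eIdx`
sending `e` to the index `0` (`toFin`, `ofFin`; multiplicative, `ᴴ`-compatible, unitary- and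
Frobenius-norm-preserving).

* `rot w` — for `w ∈ ℂ^N`, `|w| ≤ 1`, the **rotation** `R(w) = [[1 - w w*/(1+c), w], [-w*, c]]`,
  `c = √(1 - |w|²)`, the unitary (`rot_mem_unitaryGroup`) taking `e` to the unit vector `(w, c)`,
  with `R(0) = 1`; it is a real-analytic section of the column map near `e`.
* `bd W u = diag(W, u)` — block-diagonal matrices, the fibre `U(N) × U(1)`.
* `eq_bd_of_apply_inl_inr` — a unitary with `M e = u e` is `diag(W, u)`.
* `uOf M`, `wOf M`, `WOf M` — the **fibration coordinates** of a unitary `M`: the phase `u` of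
  `M_{ee}` (`phaseOf`, junk value `1` at `0`), the rotated head `w = ū · (M_{je})_j` of the last
  column, and `W = (R(w)ᴴ M)₁₁ ∈ U(N)`; `eq_rot_mul_bd`: **`M = R(w) · diag(W, u)`** for every
  unitary `M`, and conversely `uOf/wOf/WOf_rot_mul_bd` recover `(u, w, W)` from `R(w) diag(W, u)`
  when `|w| < 1`.
* Equivariance under right multiplication by `diag(g, z)`: `u ↦ u z`, `w ↦ w`, `W ↦ W g`
  (`uOf_mul_bd`, `wOf_mul_bd`, `WOf_mul_bd`), the symmetries from which the product structure of
  Haar measure in these coordinates is derived in `UnitaryColumnLaw`.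

## References

* S. Chatterjee, *The leading term of the Yang–Mills free energy*, J. Funct. Anal. 271 (2016)
  2944–3005, arXiv:1602.01222, §6 (Thm. 6.1). [arXiv160201222]
* Standard: the fibration `U(N) → U(N+1) → S^{2N+1}`, e.g. J. Faraut, *Analysis on Lie groups*,
  CUP 2008, §9.
-/

noncomputable section

open Matrix Complex
open Literature.Probability.RandomMatrix (nsq nsq_nonneg nsq_eq_zero_iff)

namespace Literature.MathematicalPhysics.QuantumFieldTheory

namespace UnitaryColumn

variable {N : ℕ}

/-- Index type `Fin N ⊕ Fin 1` of the block decomposition `ℂ^{N+1} = ℂ^N ⊕ ℂ`. [folklore] -/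
abbrev Idx (N : ℕ) : Type := Fin N ⊕ Fin 1

/-- `Σ conj(w j) w j = nsq w`. [folklore] -/
theorem sum_conj_mul_self (w : Fin N → ℂ) :
    ∑ j, (starRingEnd ℂ) (w j) * w j = (nsq w : ℂ) := by
  simp only [nsq, Complex.ofReal_sum, Complex.ofReal_pow]
  refine Finset.sum_congr rfl fun j _ => ?_
  rw [← Complex.normSq_eq_conj_mul_self, Complex.normSq_eq_norm_sq, Complex.ofReal_pow]

/-- The cosine `c(w) = √(1 - |w|²)`. [folklore] -/
def cw (w : Fin N → ℂ) : ℝ := Real.sqrt (1 - nsq w)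

/-- `c(w) ≥ 0`. [folklore] -/
theorem cw_nonneg (w : Fin N → ℂ) : 0 ≤ cw w := Real.sqrt_nonneg _

/-- `1 + c(w) > 0` (the denominator of `R(w)` never vanishes). [folklore] -/
theorem one_add_cw_pos (w : Fin N → ℂ) : 0 < 1 + cw w :=
  lt_of_lt_of_le one_pos (le_add_of_nonneg_right (cw_nonneg w))

/-- `c(w)² = 1 - |w|²` for `|w| ≤ 1`. [folklore] -/
theorem cw_sq {w : Fin N → ℂ} (hw : nsq w ≤ 1) : cw w ^ 2 = 1 - nsq w :=
  Real.sq_sqrt (by linarith)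

/-- The key identity `nsq w = (1 - c)(1 + c)`. [folklore] -/
theorem nsq_eq {w : Fin N → ℂ} (hw : nsq w ≤ 1) : nsq w = (1 - cw w) * (1 + cw w) := by
  have := cw_sq hw; nlinarith [this]

/-- The rotation `R(w)` of `ℂ^N ⊕ ℂ` taking the last basis vector `e` to `(w, c(w))`:
`R(w) = [[1 - w w*/(1+c), w], [-w*, c]]`. [folklore] -/
def rot (w : Fin N → ℂ) : Matrix (Idx N) (Idx N) ℂ :=
  Matrix.of fun i k =>
    match i, k with
    | Sum.inl j, Sum.inl k => (if j = k then 1 else 0) - w j * (starRingEnd ℂ) (w k) / (1 + cw w)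
    | Sum.inl j, Sum.inr _ => w j
    | Sum.inr _, Sum.inl k => -(starRingEnd ℂ) (w k)
    | Sum.inr _, Sum.inr _ => (cw w : ℂ)

/-- Upper-left block of `R(w)`. [folklore] -/
@[simp] theorem rot_inl_inl (w : Fin N → ℂ) (j k : Fin N) :
    rot w (Sum.inl j) (Sum.inl k) = (if j = k then 1 else 0) - w j * (starRingEnd ℂ) (w k) / (1 + cw w) := rfl
/-- Upper-right block (last column, head) of `R(w)`. [folklore] -/
@[simp] theorem rot_inl_inr (w : Fin N → ℂ) (j : Fin N) (u : Fin 1) :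
    rot w (Sum.inl j) (Sum.inr u) = w j := rfl
/-- Lower-left block (last row) of `R(w)`. [folklore] -/
@[simp] theorem rot_inr_inl (w : Fin N → ℂ) (u : Fin 1) (k : Fin N) :
    rot w (Sum.inr u) (Sum.inl k) = -(starRingEnd ℂ) (w k) := rfl
/-- Lower-right entry `c(w)` of `R(w)`. [folklore] -/
@[simp] theorem rot_inr_inr (w : Fin N → ℂ) (u u' : Fin 1) :
    rot w (Sum.inr u) (Sum.inr u') = (cw w : ℂ) := rfl

/-- `w ↦ c(w)` is continuous. [folklore] -/
theorem continuous_cw : Continuous (cw : (Fin N → ℂ) → ℝ) :=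
  Real.continuous_sqrt.comp (continuous_const.sub Literature.Probability.RandomMatrix.continuous_nsq)

/-- Every entry of `R(w)` depends continuously on `w`. [folklore] -/
theorem continuous_rot_apply (i k : Idx N) : Continuous fun w : Fin N → ℂ => rot w i k := by
  rcases i with j | u <;> rcases k with k | u'
  · simp only [rot_inl_inl]
    refine continuous_const.sub ?_
    refine Continuous.div (by fun_prop) (continuous_const.add (Complex.continuous_ofReal.comp continuous_cw))
      fun w => ?_
    exact_mod_cast (one_add_cw_pos w).ne'
  · simp only [rot_inl_inr]; fun_prop
  · simp only [rot_inr_inl]; fun_prop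
  · simp only [rot_inr_inr]; exact Complex.continuous_ofReal.comp continuous_cw

/-- `R(w)` is unitary for `|w| ≤ 1`. [folklore] -/
theorem rot_mem_unitaryGroup {w : Fin N → ℂ} (hw : nsq w ≤ 1) :
    rot w ∈ Matrix.unitaryGroup (Idx N) ℂ := by
  rw [Matrix.mem_unitaryGroup_iff']
  have hc := one_add_cw_pos w
  have hc' : (1 + (cw w : ℂ)) ≠ 0 := by exact_mod_cast hc.ne'
  have key : (nsq w : ℂ) = (1 - cw w) * (1 + cw w) := by exact_mod_cast nsq_eq hw
  have hcr : (starRingEnd ℂ) (1 + (cw w : ℂ)) = 1 + cw w := by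
    rw [map_add, map_one, Complex.conj_ofReal]
  ext i k
  rw [Matrix.mul_apply, Fintype.sum_sum_type, Fin.sum_univ_one]
  rcases i with j | u <;> rcases k with k | u'
  · -- block (1,1)
    simp only [star_apply, RCLike.star_def, rot_inl_inl, rot_inr_inl, map_sub, map_div₀, map_mul,
      Complex.conj_conj, hcr, apply_ite (starRingEnd ℂ), map_one, map_zero, map_neg, Matrix.one_apply,
      Sum.inl.injEq]
    have S1 : ∑ x : Fin N, ((if x = j then (1 : ℂ) else 0) * if x = k then 1 else 0) =
        if j = k then 1 else 0 := by
      simp only [boole_mul, Finset.sum_ite_eq', Finset.mem_univ, if_true]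
    have S2 : ∑ x : Fin N, (if x = j then (1 : ℂ) else 0) * (w x * (starRingEnd ℂ) (w k) / (1 + cw w)) =
        w j * (starRingEnd ℂ) (w k) / (1 + cw w) := by
      simp only [boole_mul, Finset.sum_ite_eq', Finset.mem_univ, if_true]
    have S3 : ∑ x : Fin N, (starRingEnd ℂ) (w x) * w j / (1 + cw w) * (if x = k then (1 : ℂ) else 0) =
        (starRingEnd ℂ) (w k) * w j / (1 + cw w) := by
      simp only [mul_boole, Finset.sum_ite_eq', Finset.mem_univ, if_true]
    have S4 : ∑ x : Fin N, (starRingEnd ℂ) (w x) * w j / (1 + cw w) *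
        (w x * (starRingEnd ℂ) (w k) / (1 + cw w)) =
        (nsq w : ℂ) * (w j * (starRingEnd ℂ) (w k) / (1 + cw w) ^ 2) := by
      rw [← sum_conj_mul_self, Finset.sum_mul]
      refine Finset.sum_congr rfl fun x _ => ?_
      field_simp
    have hsum : ∑ x : Fin N, ((if x = j then (1 : ℂ) else 0) - (starRingEnd ℂ) (w x) * w j / (1 + cw w)) *
        ((if x = k then (1 : ℂ) else 0) - w x * (starRingEnd ℂ) (w k) / (1 + cw w)) =
        (if j = k then 1 else 0) - w j * (starRingEnd ℂ) (w k) / (1 + cw w)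
          - (starRingEnd ℂ) (w k) * w j / (1 + cw w)
          + (nsq w : ℂ) * (w j * (starRingEnd ℂ) (w k) / (1 + cw w) ^ 2) := by
      simp only [sub_mul, mul_sub, Finset.sum_sub_distrib, S1, S2, S3, S4]
      ring
    rw [hsum, key]
    field_simp
    ring
  · -- block (1,2)
    simp only [star_apply, RCLike.star_def, rot_inl_inl, rot_inl_inr, rot_inr_inl, rot_inr_inr, map_sub,
      map_div₀, map_mul, Complex.conj_conj, hcr, apply_ite (starRingEnd ℂ), map_one, map_zero, map_neg,
      Matrix.one_apply, Sum.inl_ne_inr, if_false]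
    have S2 : ∑ x : Fin N, (if x = j then (1 : ℂ) else 0) * w x = w j := by
      simp only [boole_mul, Finset.sum_ite_eq', Finset.mem_univ, if_true]
    have S4 : ∑ x : Fin N, (starRingEnd ℂ) (w x) * w j / (1 + cw w) * w x =
        (nsq w : ℂ) * (w j / (1 + cw w)) := by
      rw [← sum_conj_mul_self, Finset.sum_mul]
      refine Finset.sum_congr rfl fun x _ => ?_
      field_simp
    have hsum : ∑ x : Fin N, ((if x = j then (1 : ℂ) else 0) - (starRingEnd ℂ) (w x) * w j / (1 + cw w)) * w x =
        w j - (nsq w : ℂ) * (w j / (1 + cw w)) := by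
      simp only [sub_mul, Finset.sum_sub_distrib, S2, S4]
    rw [hsum, key]
    field_simp
    ring
  · -- block (2,1)
    simp only [star_apply, RCLike.star_def, rot_inl_inl, rot_inl_inr, rot_inr_inl, rot_inr_inr,
      Complex.conj_ofReal, Matrix.one_apply, Sum.inr_ne_inl, if_false]
    have S3 : ∑ x : Fin N, (starRingEnd ℂ) (w x) * (if x = k then (1 : ℂ) else 0) = (starRingEnd ℂ) (w k) := by
      simp only [mul_boole, Finset.sum_ite_eq', Finset.mem_univ, if_true]
    have S4 : ∑ x : Fin N, (starRingEnd ℂ) (w x) * (w x * (starRingEnd ℂ) (w k) / (1 + cw w)) =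
        (nsq w : ℂ) * ((starRingEnd ℂ) (w k) / (1 + cw w)) := by
      rw [← sum_conj_mul_self, Finset.sum_mul]
      refine Finset.sum_congr rfl fun x _ => ?_
      field_simp
    have hsum : ∑ x : Fin N, (starRingEnd ℂ) (w x) *
        ((if x = k then (1 : ℂ) else 0) - w x * (starRingEnd ℂ) (w k) / (1 + cw w)) =
        (starRingEnd ℂ) (w k) - (nsq w : ℂ) * ((starRingEnd ℂ) (w k) / (1 + cw w)) := by
      simp only [mul_sub, Finset.sum_sub_distrib, S3, S4]
    rw [hsum, key]
    field_simp
    ring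
  · -- block (2,2)
    obtain rfl : u = u' := Subsingleton.elim _ _
    simp only [star_apply, RCLike.star_def, rot_inl_inr, rot_inr_inr, Complex.conj_ofReal,
      sum_conj_mul_self, key, Matrix.one_apply_eq]
    ring

/-- `|0|² = 0`. [folklore] -/
theorem nsq_zero : nsq (0 : Fin N → ℂ) = 0 := by simp [nsq]

/-- `c(0) = 1`. [folklore] -/
@[simp] theorem cw_zero : cw (0 : Fin N → ℂ) = 1 := by simp [cw, nsq_zero]

/-- `R(0) = 1`. [folklore] -/
@[simp] theorem rot_zero : rot (0 : Fin N → ℂ) = 1 := by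
  ext i k
  rcases i with j | u <;> rcases k with k | u'
  · simp [Matrix.one_apply]
  · simp
  · simp
  · obtain rfl : u = u' := Subsingleton.elim _ _
    simp

/-- `(rot w)ᴴ * rot w = 1` for `|w| ≤ 1`. [folklore] -/
theorem conjTranspose_rot_mul_self {w : Fin N → ℂ} (hw : nsq w ≤ 1) : (rot w)ᴴ * rot w = 1 := by
  have h := rot_mem_unitaryGroup hw
  rw [Matrix.mem_unitaryGroup_iff', star_eq_conjTranspose] at h
  exact h

/-- `rot w * (rot w)ᴴ = 1` for `|w| ≤ 1`. [folklore] -/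
theorem rot_mul_conjTranspose_self {w : Fin N → ℂ} (hw : nsq w ≤ 1) : rot w * (rot w)ᴴ = 1 := by
  have h := rot_mem_unitaryGroup hw
  rw [Matrix.mem_unitaryGroup_iff, star_eq_conjTranspose] at h
  exact h

/-! ### Block-diagonal matrices `diag(W, u)` -/

/-- The block-diagonal matrix `diag(W, u)` on `ℂ^N ⊕ ℂ`. [folklore] -/
def bd (W : Matrix (Fin N) (Fin N) ℂ) (u : ℂ) : Matrix (Idx N) (Idx N) ℂ :=
  Matrix.fromBlocks W 0 0 (u • (1 : Matrix (Fin 1) (Fin 1) ℂ))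

/-- Upper-left block of `diag(W, u)`. [folklore] -/
@[simp] theorem bd_inl_inl (W : Matrix (Fin N) (Fin N) ℂ) (u : ℂ) (j k : Fin N) :
    bd W u (Sum.inl j) (Sum.inl k) = W j k := rfl
/-- Upper-right block of `diag(W, u)` vanishes. [folklore] -/
@[simp] theorem bd_inl_inr (W : Matrix (Fin N) (Fin N) ℂ) (u : ℂ) (j : Fin N) (i : Fin 1) :
    bd W u (Sum.inl j) (Sum.inr i) = 0 := rfl
/-- Lower-left block of `diag(W, u)` vanishes. [folklore] -/
@[simp] theorem bd_inr_inl (W : Matrix (Fin N) (Fin N) ℂ) (u : ℂ) (i : Fin 1) (k : Fin N) :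
    bd W u (Sum.inr i) (Sum.inl k) = 0 := rfl
/-- Lower-right entry of `diag(W, u)`. [folklore] -/
@[simp] theorem bd_inr_inr (W : Matrix (Fin N) (Fin N) ℂ) (u : ℂ) (i i' : Fin 1) :
    bd W u (Sum.inr i) (Sum.inr i') = u := by
  obtain rfl : i = i' := Subsingleton.elim _ _
  simp [bd]

/-- `diag(W, u) diag(W', u') = diag(WW', uu')`. [folklore] -/
theorem bd_mul_bd (W W' : Matrix (Fin N) (Fin N) ℂ) (u u' : ℂ) :
    bd W u * bd W' u' = bd (W * W') (u * u') := by
  simp only [bd, Matrix.fromBlocks_multiply, Matrix.mul_zero, Matrix.zero_mul, add_zero, zero_add,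
    Matrix.smul_mul, Matrix.mul_smul, Matrix.one_mul, smul_smul, smul_zero, mul_comm u' u]

/-- `diag(W, u)ᴴ = diag(Wᴴ, ū)`. [folklore] -/
theorem conjTranspose_bd (W : Matrix (Fin N) (Fin N) ℂ) (u : ℂ) :
    (bd W u)ᴴ = bd Wᴴ ((starRingEnd ℂ) u) := by
  simp only [bd, Matrix.fromBlocks_conjTranspose, Matrix.conjTranspose_zero, Matrix.conjTranspose_smul,
    Matrix.conjTranspose_one, RCLike.star_def]

/-- `diag(1, 1) = 1`. [folklore] -/
@[simp] theorem bd_one_one : bd (1 : Matrix (Fin N) (Fin N) ℂ) 1 = 1 := by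
  simp only [bd, one_smul, Matrix.fromBlocks_one]

/-- `diag(W, u)` determines `W` and `u`. [folklore] -/
theorem bd_inj {W W' : Matrix (Fin N) (Fin N) ℂ} {u u' : ℂ} (h : bd W u = bd W' u') : W = W' ∧ u = u' := by
  refine ⟨?_, ?_⟩
  · ext j k
    have := congr_fun (congr_fun h (Sum.inl j)) (Sum.inl k)
    simpa using this
  · have := congr_fun (congr_fun h (Sum.inr 0)) (Sum.inr 0)
    simpa using this

/-- `diag(W, u)` is unitary when `W` is unitary and `|u| = 1`. [folklore] -/
theorem bd_mem_unitaryGroup {W : Matrix (Fin N) (Fin N) ℂ} (hW : W ∈ Matrix.unitaryGroup (Fin N) ℂ)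
    {u : ℂ} (hu : ‖u‖ = 1) : bd W u ∈ Matrix.unitaryGroup (Idx N) ℂ := by
  rw [Matrix.mem_unitaryGroup_iff', star_eq_conjTranspose, conjTranspose_bd, bd_mul_bd]
  rw [Matrix.mem_unitaryGroup_iff', star_eq_conjTranspose] at hW
  rw [hW, ← Complex.normSq_eq_conj_mul_self, Complex.normSq_eq_norm_sq, hu]
  simp

/-- Converse: if `diag(W, u)` is unitary then `W` is unitary and `|u| = 1`. [folklore] -/
theorem mem_unitaryGroup_of_bd {W : Matrix (Fin N) (Fin N) ℂ} {u : ℂ}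
    (h : bd W u ∈ Matrix.unitaryGroup (Idx N) ℂ) : W ∈ Matrix.unitaryGroup (Fin N) ℂ ∧ ‖u‖ = 1 := by
  rw [Matrix.mem_unitaryGroup_iff', star_eq_conjTranspose, conjTranspose_bd, bd_mul_bd, ← bd_one_one] at h
  obtain ⟨h1, h2⟩ := bd_inj h
  refine ⟨by rwa [Matrix.mem_unitaryGroup_iff', star_eq_conjTranspose], ?_⟩
  rw [← Complex.normSq_eq_conj_mul_self] at h2
  have h3 : Complex.normSq u = 1 := by exact_mod_cast h2
  rw [Complex.normSq_eq_norm_sq] at h3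
  have h4 : 0 ≤ ‖u‖ := norm_nonneg u
  nlinarith [h3, h4]

/-! ### A unitary fixing the line `ℂ e` is block diagonal -/

/-- Squared norm of a column of a unitary matrix is `1`. [folklore] -/
theorem sum_normSq_col {ι : Type*} [Fintype ι] [DecidableEq ι] {M : Matrix ι ι ℂ}
    (hM : M ∈ Matrix.unitaryGroup ι ℂ) (k : ι) : ∑ i, Complex.normSq (M i k) = 1 := by
  rw [Matrix.mem_unitaryGroup_iff'] at hM
  have h := congr_fun (congr_fun hM k) k
  rw [Matrix.mul_apply, Matrix.one_apply_eq] at h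
  have h' : ∑ i, (Complex.normSq (M i k) : ℂ) = 1 := by
    rw [← h]
    refine Finset.sum_congr rfl fun i _ => ?_
    rw [star_apply, RCLike.star_def, Complex.normSq_eq_conj_mul_self]
  exact_mod_cast h'

/-- Squared norm of a row of a unitary matrix is `1`. [folklore] -/
theorem sum_normSq_row {ι : Type*} [Fintype ι] [DecidableEq ι] {M : Matrix ι ι ℂ}
    (hM : M ∈ Matrix.unitaryGroup ι ℂ) (i : ι) : ∑ k, Complex.normSq (M i k) = 1 := by
  rw [Matrix.mem_unitaryGroup_iff] at hM
  have h := congr_fun (congr_fun hM i) i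
  rw [Matrix.mul_apply, Matrix.one_apply_eq] at h
  have h' : ∑ k, (Complex.normSq (M i k) : ℂ) = 1 := by
    rw [← h]
    refine Finset.sum_congr rfl fun k _ => ?_
    rw [star_apply, RCLike.star_def, mul_comm, Complex.normSq_eq_conj_mul_self]
  exact_mod_cast h'

/-- **A unitary `M` of `ℂ^N ⊕ ℂ` with `M e = u e` (`e` the last basis vector) is block diagonal:**
`M = diag(W, u)` with `W` unitary and `|u| = 1`. [folklore] -/
theorem eq_bd_of_apply_inl_inr {M : Matrix (Idx N) (Idx N) ℂ} (hM : M ∈ Matrix.unitaryGroup (Idx N) ℂ)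
    (h : ∀ j : Fin N, M (Sum.inl j) (Sum.inr 0) = 0) :
    M = bd M.toBlocks₁₁ (M (Sum.inr 0) (Sum.inr 0)) ∧
      M.toBlocks₁₁ ∈ Matrix.unitaryGroup (Fin N) ℂ ∧ ‖M (Sum.inr 0) (Sum.inr 0)‖ = 1 := by
  -- the last column has norm 1, so `|u| = 1`
  have hcol := sum_normSq_col hM (Sum.inr 0)
  rw [Fintype.sum_sum_type, Fin.sum_univ_one] at hcol
  have h0 : ∑ j : Fin N, Complex.normSq (M (Sum.inl j) (Sum.inr 0)) = 0 :=
    Finset.sum_eq_zero fun j _ => by rw [h j, map_zero]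
  rw [h0, zero_add] at hcol
  -- the last row has norm 1, so its other entries vanish
  have hrow := sum_normSq_row hM (Sum.inr 0)
  rw [Fintype.sum_sum_type, Fin.sum_univ_one, hcol] at hrow
  have hrow0 : ∑ k : Fin N, Complex.normSq (M (Sum.inr 0) (Sum.inl k)) = 0 := by linarith
  have hrow' : ∀ k : Fin N, M (Sum.inr 0) (Sum.inl k) = 0 := by
    intro k
    have := (Finset.sum_eq_zero_iff_of_nonneg fun k _ => Complex.normSq_nonneg _).1 hrow0 k
      (Finset.mem_univ k)
    exact Complex.normSq_eq_zero.1 this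
  have hM' : M = bd M.toBlocks₁₁ (M (Sum.inr 0) (Sum.inr 0)) := by
    ext i k
    rcases i with j | i <;> rcases k with k | i'
    · rfl
    · obtain rfl : i' = 0 := Subsingleton.elim _ _
      rw [bd_inl_inr, h j]
    · obtain rfl : i = 0 := Subsingleton.elim _ _
      rw [bd_inr_inl, hrow' k]
    · obtain rfl : i = 0 := Subsingleton.elim _ _
      obtain rfl : i' = 0 := Subsingleton.elim _ _
      rw [bd_inr_inr]
  have hu := mem_unitaryGroup_of_bd (hM' ▸ hM)
  exact ⟨hM', hu.1, hu.2⟩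

/-! ### Reindexing `Fin N ⊕ Fin 1 ≃ Fin (N+1)` (the block `Fin 1` goes to index `0`) -/

/-- The reindexing `Fin N ⊕ Fin 1 ≃ Fin (N+1)` sending the distinguished summand to `0` and
`inl j` to `j+1`. [folklore] -/
def eIdx (N : ℕ) : Idx N ≃ Fin (N + 1) := finSumFinEquiv.trans (finRotate (N + 1))

/-- The distinguished summand goes to index `0`. [folklore] -/
@[simp] theorem eIdx_inr (i : Fin 1) : eIdx N (Sum.inr i) = 0 := by
  obtain rfl : i = 0 := Subsingleton.elim _ _
  have h : (finSumFinEquiv (Sum.inr (0 : Fin 1)) : Fin (N + 1)) = Fin.last N := by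
    ext; simp [finSumFinEquiv_apply_right]
  simp [eIdx, h]

/-- `inl j` goes to `j + 1`. [folklore] -/
@[simp] theorem eIdx_inl (j : Fin N) : eIdx N (Sum.inl j) = j.succ := by
  have h : (finSumFinEquiv (Sum.inl j) : Fin (N + 1)) = Fin.castSucc j := by
    ext; simp [finSumFinEquiv_apply_left]
  rw [eIdx, Equiv.trans_apply, h]
  ext
  rw [coe_finRotate_of_ne_last (Fin.castSucc_lt_last j).ne]
  simp

/-- Inverse reindexing at `0`. [folklore] -/
@[simp] theorem eIdx_symm_zero : (eIdx N).symm 0 = Sum.inr 0 := by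
  rw [Equiv.symm_apply_eq, eIdx_inr]

/-- Inverse reindexing at `j + 1`. [folklore] -/
@[simp] theorem eIdx_symm_succ (j : Fin N) : (eIdx N).symm j.succ = Sum.inl j := by
  rw [Equiv.symm_apply_eq, eIdx_inl]

/-- Transport of a block matrix to a matrix indexed by `Fin (N+1)`. [folklore] -/
def toFin (M : Matrix (Idx N) (Idx N) ℂ) : Matrix (Fin (N + 1)) (Fin (N + 1)) ℂ :=
  Matrix.reindex (eIdx N) (eIdx N) M

/-- Inverse transport. [folklore] -/
def ofFin (A : Matrix (Fin (N + 1)) (Fin (N + 1)) ℂ) : Matrix (Idx N) (Idx N) ℂ :=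
  Matrix.reindex (eIdx N).symm (eIdx N).symm A

/-- `ofFin` is a left inverse of `toFin`. [folklore] -/
@[simp] theorem ofFin_toFin (M : Matrix (Idx N) (Idx N) ℂ) : ofFin (toFin M) = M := by
  simp [ofFin, toFin]

/-- `toFin` is a left inverse of `ofFin`. [folklore] -/
@[simp] theorem toFin_ofFin (A : Matrix (Fin (N + 1)) (Fin (N + 1)) ℂ) : toFin (ofFin A) = A := by
  simp [ofFin, toFin]

/-- Entries of `toFin M`. [folklore] -/
theorem toFin_apply (M : Matrix (Idx N) (Idx N) ℂ) (i k : Fin (N + 1)) :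
    toFin M i k = M ((eIdx N).symm i) ((eIdx N).symm k) := rfl

/-- Entries of `ofFin A`. [folklore] -/
theorem ofFin_apply (A : Matrix (Fin (N + 1)) (Fin (N + 1)) ℂ) (i k : Idx N) :
    ofFin A i k = A (eIdx N i) (eIdx N k) := rfl

/-- `toFin` is multiplicative. [folklore] -/
theorem toFin_mul (M M' : Matrix (Idx N) (Idx N) ℂ) : toFin (M * M') = toFin M * toFin M' :=
  (Matrix.submatrix_mul_equiv M M' _ _ _).symm

/-- `ofFin` is multiplicative. [folklore] -/
theorem ofFin_mul (A A' : Matrix (Fin (N + 1)) (Fin (N + 1)) ℂ) : ofFin (A * A') = ofFin A * ofFin A' :=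
  (Matrix.submatrix_mul_equiv A A' _ _ _).symm

/-- `toFin 1 = 1`. [folklore] -/
@[simp] theorem toFin_one : toFin (1 : Matrix (Idx N) (Idx N) ℂ) = 1 := by
  simp [toFin]

/-- `ofFin 1 = 1`. [folklore] -/
@[simp] theorem ofFin_one : ofFin (1 : Matrix (Fin (N + 1)) (Fin (N + 1)) ℂ) = 1 := by
  simp [ofFin]

/-- `toFin` commutes with the conjugate transpose. [folklore] -/
theorem conjTranspose_toFin (M : Matrix (Idx N) (Idx N) ℂ) : (toFin M)ᴴ = toFin Mᴴ :=
  Matrix.conjTranspose_reindex _ _ _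

/-- `ofFin` commutes with the conjugate transpose. [folklore] -/
theorem conjTranspose_ofFin (A : Matrix (Fin (N + 1)) (Fin (N + 1)) ℂ) : (ofFin A)ᴴ = ofFin Aᴴ :=
  Matrix.conjTranspose_reindex _ _ _

/-- `toFin` preserves unitarity. [folklore] -/
theorem toFin_mem_unitaryGroup {M : Matrix (Idx N) (Idx N) ℂ} (hM : M ∈ Matrix.unitaryGroup (Idx N) ℂ) :
    toFin M ∈ Matrix.unitaryGroup (Fin (N + 1)) ℂ := by
  rw [Matrix.mem_unitaryGroup_iff', star_eq_conjTranspose] at hM ⊢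
  rw [conjTranspose_toFin, ← toFin_mul, hM, toFin_one]

/-- `ofFin` preserves unitarity. [folklore] -/
theorem ofFin_mem_unitaryGroup {A : Matrix (Fin (N + 1)) (Fin (N + 1)) ℂ}
    (hA : A ∈ Matrix.unitaryGroup (Fin (N + 1)) ℂ) : ofFin A ∈ Matrix.unitaryGroup (Idx N) ℂ := by
  rw [Matrix.mem_unitaryGroup_iff', star_eq_conjTranspose] at hA ⊢
  rw [conjTranspose_ofFin, ← ofFin_mul, hA, ofFin_one]

/-- The Frobenius norm is invariant under the reindexing. [folklore] -/
theorem frobenius_norm_toFin (M : Matrix (Idx N) (Idx N) ℂ) :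
    @norm _ Matrix.frobeniusSeminormedAddCommGroup.toNorm (toFin M) =
      @norm _ Matrix.frobeniusSeminormedAddCommGroup.toNorm M := by
  rw [Matrix.frobenius_norm_def, Matrix.frobenius_norm_def]
  congr 1
  simp only [toFin_apply]
  rw [Equiv.sum_comp (eIdx N).symm (fun i => ∑ x, ‖M i ((eIdx N).symm x)‖ ^ (2 : ℝ))]
  exact Finset.sum_congr rfl fun i _ =>
    Equiv.sum_comp (eIdx N).symm (fun k => ‖M i k‖ ^ (2 : ℝ))

/-! ### Polar decomposition of the last column -/

/-- The phase `z/|z|` of a complex number (junk value `1` at `0`). [folklore] -/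
def phaseOf (z : ℂ) : ℂ := if z = 0 then 1 else z / (‖z‖ : ℂ)

/-- `|phaseOf z| = 1`. [folklore] -/
theorem norm_phaseOf (z : ℂ) : ‖phaseOf z‖ = 1 := by
  unfold phaseOf
  split_ifs with h
  · simp
  · rw [norm_div, Complex.norm_real, Real.norm_eq_abs, abs_norm, div_self (norm_ne_zero_iff.2 h)]

/-- `phaseOf z ≠ 0`. [folklore] -/
theorem phaseOf_ne_zero (z : ℂ) : phaseOf z ≠ 0 :=
  norm_ne_zero_iff.1 (by rw [norm_phaseOf]; exact one_ne_zero)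

/-- `phaseOf z · |z| = z` (also at `z = 0`). [folklore] -/
theorem phaseOf_mul_norm (z : ℂ) : phaseOf z * (‖z‖ : ℂ) = z := by
  unfold phaseOf
  split_ifs with h
  · simp [h]
  · rw [div_mul_cancel₀ _ (by exact_mod_cast norm_ne_zero_iff.2 h)]

/-- `conj(phaseOf z) phaseOf z = 1`. [folklore] -/
theorem conj_phaseOf_mul_phaseOf (z : ℂ) : (starRingEnd ℂ) (phaseOf z) * phaseOf z = 1 := by
  rw [← Complex.normSq_eq_conj_mul_self, Complex.normSq_eq_norm_sq, norm_phaseOf]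
  simp

/-- `phaseOf (z c) = phaseOf z · c` for `z ≠ 0` and `|c| = 1`. [folklore] -/
theorem phaseOf_mul_of_ne_zero {z : ℂ} (hz : z ≠ 0) {c : ℂ} (hc : ‖c‖ = 1) :
    phaseOf (z * c) = phaseOf z * c := by
  have hc0 : c ≠ 0 := norm_ne_zero_iff.1 (by rw [hc]; exact one_ne_zero)
  unfold phaseOf
  rw [if_neg (mul_ne_zero hz hc0), if_neg hz, norm_mul, hc, mul_one]
  ring

/-- `phaseOf` is continuous away from `0`. [folklore] -/
theorem continuousOn_phaseOf : ContinuousOn phaseOf ({0}ᶜ : Set ℂ) := by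
  have h : ContinuousOn (fun z : ℂ => z / (‖z‖ : ℂ)) ({0}ᶜ : Set ℂ) :=
    continuousOn_id.div (Complex.continuous_ofReal.comp continuous_norm).continuousOn fun z hz => by
      exact_mod_cast norm_ne_zero_iff.2 hz
  refine h.congr fun z hz => ?_
  rw [phaseOf, if_neg (by simpa using hz)]

/-- `phaseOf` is measurable. [folklore] -/
theorem measurable_phaseOf : Measurable phaseOf :=
  measurable_of_continuousOn_compl_singleton 0 continuousOn_phaseOf

/-- The last column of a matrix on `ℂ^N ⊕ ℂ`. [folklore] -/
def lastCol (M : Matrix (Idx N) (Idx N) ℂ) : Idx N → ℂ := fun i => M i (Sum.inr 0)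

/-- Entries of the last column. [folklore] -/
@[simp] theorem lastCol_apply (M : Matrix (Idx N) (Idx N) ℂ) (i : Idx N) : lastCol M i = M i (Sum.inr 0) := rfl

/-- The phase `u` of the last coordinate of the last column. [folklore] -/
def uOf (M : Matrix (Idx N) (Idx N) ℂ) : ℂ := phaseOf (M (Sum.inr 0) (Sum.inr 0))

/-- The rotated head `w = ū · (v_j)_{j<N}` of the last column `v`. [folklore] -/
def wOf (M : Matrix (Idx N) (Idx N) ℂ) : Fin N → ℂ := fun j => (starRingEnd ℂ) (uOf M) * M (Sum.inl j) (Sum.inr 0)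

/-- `|u| = 1`. [folklore] -/
theorem norm_uOf (M : Matrix (Idx N) (Idx N) ℂ) : ‖uOf M‖ = 1 := norm_phaseOf _

/-- `|w|² = 1 - |M_{ee}|²` for unitary `M`. [folklore] -/
theorem nsq_wOf {M : Matrix (Idx N) (Idx N) ℂ} (hM : M ∈ Matrix.unitaryGroup (Idx N) ℂ) :
    nsq (wOf M) = 1 - ‖M (Sum.inr 0) (Sum.inr 0)‖ ^ 2 := by
  have h := sum_normSq_col hM (Sum.inr 0)
  rw [Fintype.sum_sum_type, Fin.sum_univ_one, Complex.normSq_eq_norm_sq] at h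
  have h2 : nsq (wOf M) = ∑ j : Fin N, Complex.normSq (M (Sum.inl j) (Sum.inr 0)) := by
    unfold nsq wOf
    refine Finset.sum_congr rfl fun j _ => ?_
    rw [norm_mul, Complex.norm_conj, norm_uOf, one_mul, Complex.normSq_eq_norm_sq]
  rw [h2]
  linarith

/-- `|w| ≤ 1` for unitary `M`. [folklore] -/
theorem nsq_wOf_le {M : Matrix (Idx N) (Idx N) ℂ} (hM : M ∈ Matrix.unitaryGroup (Idx N) ℂ) :
    nsq (wOf M) ≤ 1 := by
  rw [nsq_wOf hM]
  nlinarith [norm_nonneg (M (Sum.inr 0) (Sum.inr 0))]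

/-- `c(w) = |M_{ee}|` for unitary `M`. [folklore] -/
theorem cw_wOf {M : Matrix (Idx N) (Idx N) ℂ} (hM : M ∈ Matrix.unitaryGroup (Idx N) ℂ) :
    cw (wOf M) = ‖M (Sum.inr 0) (Sum.inr 0)‖ := by
  rw [cw, nsq_wOf hM, sub_sub_cancel, Real.sqrt_sq (norm_nonneg _)]

/-- `ū u = 1`. [folklore] -/
theorem conj_uOf_mul_uOf (M : Matrix (Idx N) (Idx N) ℂ) : (starRingEnd ℂ) (uOf M) * uOf M = 1 :=
  conj_phaseOf_mul_phaseOf _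

/-- The last column of `R(w) · diag(1, u)` is the last column of `M`. [folklore] -/
theorem lastCol_rot_mul_bd {M : Matrix (Idx N) (Idx N) ℂ} (hM : M ∈ Matrix.unitaryGroup (Idx N) ℂ)
    (i : Idx N) : (rot (wOf M) * bd (1 : Matrix (Fin N) (Fin N) ℂ) (uOf M)) i (Sum.inr 0) = M i (Sum.inr 0) := by
  rw [Matrix.mul_apply, Fintype.sum_sum_type, Fin.sum_univ_one]
  simp only [bd_inl_inr, mul_zero, Finset.sum_const_zero, zero_add, bd_inr_inr]
  rcases i with j | i
  · rw [rot_inl_inr, wOf]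
    calc (starRingEnd ℂ) (uOf M) * M (Sum.inl j) (Sum.inr 0) * uOf M
        = ((starRingEnd ℂ) (uOf M) * uOf M) * M (Sum.inl j) (Sum.inr 0) := by ring
      _ = M (Sum.inl j) (Sum.inr 0) := by rw [conj_uOf_mul_uOf, one_mul]
  · obtain rfl : i = 0 := Subsingleton.elim _ _
    rw [rot_inr_inr, cw_wOf hM, mul_comm, uOf, phaseOf_mul_norm]

/-- Matrix products only see the relevant column. [folklore] -/
theorem mul_apply_eq_of_col_eq {ι : Type*} [Fintype ι] {X M Y : Matrix ι ι ℂ} {c : ι}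
    (h : ∀ k, M k c = Y k c) (i : ι) : (X * M) i c = (X * Y) i c := by
  simp only [Matrix.mul_apply, h]

/-- The fibre coordinate: `M ↦ (R(w)ᴴ M)` has last column `u e`. [folklore] -/
theorem conjTranspose_rot_mul_apply_inr {M : Matrix (Idx N) (Idx N) ℂ}
    (hM : M ∈ Matrix.unitaryGroup (Idx N) ℂ) (i : Idx N) :
    ((rot (wOf M))ᴴ * M) i (Sum.inr 0) = bd (1 : Matrix (Fin N) (Fin N) ℂ) (uOf M) i (Sum.inr 0) := by
  rw [mul_apply_eq_of_col_eq (fun k => (lastCol_rot_mul_bd hM k).symm) i, ← Matrix.mul_assoc,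
    conjTranspose_rot_mul_self (nsq_wOf_le hM), Matrix.one_mul]

/-- The `U(N)`-coordinate `W` of `M`: the upper-left block of `R(w)ᴴ M`. [folklore] -/
def WOf (M : Matrix (Idx N) (Idx N) ℂ) : Matrix (Fin N) (Fin N) ℂ := ((rot (wOf M))ᴴ * M).toBlocks₁₁

/-- Entries of `W(M) = (R(w)ᴴ M)₁₁`. [folklore] -/
theorem WOf_apply (M : Matrix (Idx N) (Idx N) ℂ) (j k : Fin N) :
    WOf M j k = ∑ l, (starRingEnd ℂ) (rot (wOf M) l (Sum.inl j)) * M l (Sum.inl k) := rfl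

/-- **Column fibration of `U(N+1)`**: every unitary `M` of `ℂ^N ⊕ ℂ` factors as
`M = R(w) · diag(W, u)` with `w = wOf M`, `W = WOf M ∈ U(N)`, `u = uOf M`, `|u| = 1`. [folklore] -/
theorem eq_rot_mul_bd {M : Matrix (Idx N) (Idx N) ℂ} (hM : M ∈ Matrix.unitaryGroup (Idx N) ℂ) :
    M = rot (wOf M) * bd (WOf M) (uOf M) ∧ WOf M ∈ Matrix.unitaryGroup (Fin N) ℂ := by
  set P := (rot (wOf M))ᴴ * M with hP
  have hrot := rot_mem_unitaryGroup (nsq_wOf_le hM)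
  have hPu : P ∈ Matrix.unitaryGroup (Idx N) ℂ := by
    have h1 : (rot (wOf M))ᴴ ∈ Matrix.unitaryGroup (Idx N) ℂ := by
      rw [← star_eq_conjTranspose]; exact Unitary.star_mem hrot
    exact Submonoid.mul_mem _ h1 hM
  have hcol : ∀ j : Fin N, P (Sum.inl j) (Sum.inr 0) = 0 := fun j => by
    rw [hP, conjTranspose_rot_mul_apply_inr hM, bd_inl_inr]
  obtain ⟨hPeq, hW, -⟩ := eq_bd_of_apply_inl_inr hPu hcol
  have hu : P (Sum.inr 0) (Sum.inr 0) = uOf M := by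
    rw [hP, conjTranspose_rot_mul_apply_inr hM, bd_inr_inr]
  rw [hu] at hPeq
  refine ⟨?_, hW⟩
  calc M = rot (wOf M) * ((rot (wOf M))ᴴ * M) := by
        rw [← Matrix.mul_assoc, rot_mul_conjTranspose_self (nsq_wOf_le hM), Matrix.one_mul]
    _ = rot (wOf M) * bd (WOf M) (uOf M) := by rw [← hP, hPeq]; rfl

/-! ### Behaviour of the coordinates under right multiplication by `diag(g, z)` -/

/-- Right multiplication by `diag(g, z)` multiplies the last column by `z`. [folklore] -/
theorem lastCol_mul_bd (M : Matrix (Idx N) (Idx N) ℂ) (g : Matrix (Fin N) (Fin N) ℂ) (z : ℂ) (i : Idx N) :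
    (M * bd g z) i (Sum.inr 0) = M i (Sum.inr 0) * z := by
  rw [Matrix.mul_apply, Fintype.sum_sum_type, Fin.sum_univ_one]
  simp

/-- `u(M diag(g, z)) = u(M) z` when `M_{ee} ≠ 0`, `|z| = 1`. [folklore] -/
theorem uOf_mul_bd {M : Matrix (Idx N) (Idx N) ℂ} (hM0 : M (Sum.inr 0) (Sum.inr 0) ≠ 0)
    (g : Matrix (Fin N) (Fin N) ℂ) {z : ℂ} (hz : ‖z‖ = 1) : uOf (M * bd g z) = uOf M * z := by
  rw [uOf, lastCol_mul_bd, phaseOf_mul_of_ne_zero hM0 hz, uOf]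

/-- `u(M diag(g, 1)) = u(M)`. [folklore] -/
theorem uOf_mul_bd_one (M : Matrix (Idx N) (Idx N) ℂ) (g : Matrix (Fin N) (Fin N) ℂ) :
    uOf (M * bd g 1) = uOf M := by
  rw [uOf, lastCol_mul_bd, mul_one, uOf]

/-- `w(M diag(g, z)) = w(M)` when `M_{ee} ≠ 0`, `|z| = 1`. [folklore] -/
theorem wOf_mul_bd {M : Matrix (Idx N) (Idx N) ℂ} (hM0 : M (Sum.inr 0) (Sum.inr 0) ≠ 0)
    (g : Matrix (Fin N) (Fin N) ℂ) {z : ℂ} (hz : ‖z‖ = 1) : wOf (M * bd g z) = wOf M := by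
  funext j
  rw [wOf, uOf_mul_bd hM0 g hz, lastCol_mul_bd, map_mul, wOf]
  have hzz : (starRingEnd ℂ) z * z = 1 := by
    rw [← Complex.normSq_eq_conj_mul_self, Complex.normSq_eq_norm_sq, hz]; simp
  calc (starRingEnd ℂ) (uOf M) * (starRingEnd ℂ) z * (M (Sum.inl j) (Sum.inr 0) * z)
      = (starRingEnd ℂ) (uOf M) * M (Sum.inl j) (Sum.inr 0) * ((starRingEnd ℂ) z * z) := by ring
    _ = (starRingEnd ℂ) (uOf M) * M (Sum.inl j) (Sum.inr 0) := by rw [hzz, mul_one]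

/-- `w(M diag(g, 1)) = w(M)`. [folklore] -/
theorem wOf_mul_bd_one (M : Matrix (Idx N) (Idx N) ℂ) (g : Matrix (Fin N) (Fin N) ℂ) :
    wOf (M * bd g 1) = wOf M := by
  funext j
  rw [wOf, uOf_mul_bd_one, lastCol_mul_bd, mul_one, wOf]

/-- Upper-left block of `P diag(g, z)`. [folklore] -/
theorem toBlocks₁₁_mul_bd (P : Matrix (Idx N) (Idx N) ℂ) (g : Matrix (Fin N) (Fin N) ℂ) (z : ℂ) :
    (P * bd g z).toBlocks₁₁ = P.toBlocks₁₁ * g := by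
  conv_lhs => rw [← Matrix.fromBlocks_toBlocks P]
  rw [bd, Matrix.fromBlocks_multiply, Matrix.toBlocks_fromBlocks₁₁, Matrix.mul_zero, add_zero]

/-- `W(M diag(g, z)) = W(M) g` as soon as `w` is unchanged. [folklore] -/
theorem WOf_mul_bd_of_wOf_eq {M : Matrix (Idx N) (Idx N) ℂ} {g : Matrix (Fin N) (Fin N) ℂ} {z : ℂ}
    (hw : wOf (M * bd g z) = wOf M) : WOf (M * bd g z) = WOf M * g := by
  rw [WOf, hw, ← Matrix.mul_assoc, toBlocks₁₁_mul_bd, WOf]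

/-- `W(M diag(g, z)) = W(M) g` when `M_{ee} ≠ 0`, `|z| = 1`. [folklore] -/
theorem WOf_mul_bd {M : Matrix (Idx N) (Idx N) ℂ} (hM0 : M (Sum.inr 0) (Sum.inr 0) ≠ 0)
    (g : Matrix (Fin N) (Fin N) ℂ) {z : ℂ} (hz : ‖z‖ = 1) : WOf (M * bd g z) = WOf M * g :=
  WOf_mul_bd_of_wOf_eq (wOf_mul_bd hM0 g hz)

/-- `W(M diag(g, 1)) = W(M) g`. [folklore] -/
theorem WOf_mul_bd_one (M : Matrix (Idx N) (Idx N) ℂ) (g : Matrix (Fin N) (Fin N) ℂ) :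
    WOf (M * bd g 1) = WOf M * g :=
  WOf_mul_bd_of_wOf_eq (wOf_mul_bd_one M g)

/-! ### Coordinates of `R(w) · diag(W, u)` -/

/-- Last column of `R(w) diag(W, u)` is `u` times the last column of `R(w)`. [folklore] -/
theorem lastCol_rot_mul_bd' (w : Fin N → ℂ) (W : Matrix (Fin N) (Fin N) ℂ) (u : ℂ) (i : Idx N) :
    (rot w * bd W u) i (Sum.inr 0) = rot w i (Sum.inr 0) * u := by
  rw [Matrix.mul_apply, Fintype.sum_sum_type, Fin.sum_univ_one]
  simp

/-- The `u`-coordinate of `R(w) diag(W, u)` is `u` (`|w| < 1`). [folklore] -/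
theorem uOf_rot_mul_bd {w : Fin N → ℂ} (hw : nsq w < 1) (W : Matrix (Fin N) (Fin N) ℂ) {u : ℂ}
    (hu : ‖u‖ = 1) : uOf (rot w * bd W u) = u := by
  have hc : 0 < cw w := Real.sqrt_pos.2 (by linarith)
  rw [uOf, lastCol_rot_mul_bd', rot_inr_inr, phaseOf, if_neg, norm_mul, Complex.norm_real,
    Real.norm_eq_abs, abs_of_pos hc, hu, mul_one, mul_div_cancel_left₀ _ (by exact_mod_cast hc.ne')]
  exact mul_ne_zero (by exact_mod_cast hc.ne') (norm_ne_zero_iff.1 (by rw [hu]; exact one_ne_zero))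

/-- The `w`-coordinate of `R(w) diag(W, u)` is `w` (`|w| < 1`). [folklore] -/
theorem wOf_rot_mul_bd {w : Fin N → ℂ} (hw : nsq w < 1) (W : Matrix (Fin N) (Fin N) ℂ) {u : ℂ}
    (hu : ‖u‖ = 1) : wOf (rot w * bd W u) = w := by
  funext j
  rw [wOf, uOf_rot_mul_bd hw W hu, lastCol_rot_mul_bd', rot_inl_inr]
  have huu : (starRingEnd ℂ) u * u = 1 := by
    rw [← Complex.normSq_eq_conj_mul_self, Complex.normSq_eq_norm_sq, hu]; simp
  calc (starRingEnd ℂ) u * (w j * u) = w j * ((starRingEnd ℂ) u * u) := by ring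
    _ = w j := by rw [huu, mul_one]

/-- The `W`-coordinate of `R(w) diag(W, u)` is `W` (`|w| < 1`). [folklore] -/
theorem WOf_rot_mul_bd {w : Fin N → ℂ} (hw : nsq w < 1) (W : Matrix (Fin N) (Fin N) ℂ) {u : ℂ}
    (hu : ‖u‖ = 1) : WOf (rot w * bd W u) = W := by
  rw [WOf, wOf_rot_mul_bd hw W hu, ← Matrix.mul_assoc, conjTranspose_rot_mul_self hw.le, Matrix.one_mul,
    bd, Matrix.toBlocks_fromBlocks₁₁]

end UnitaryColumn

end Literature.MathematicalPhysics.QuantumFieldTheory
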